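import Mathlib
import Literature.NumberTheory.Sieve.LinearEquationsInPrimes
import Summits.Parity.GeneralizedHardyLittlewood.Theorems.LiouvilleShiftedTablesPairsToGHLStubRungAtomsAux1
import Summits.Parity.GeneralizedHardyLittlewood.Theorems.LiouvilleShiftedTablesPairsToGHLStubRungLevelAux1

/-!
# Sloped ladder — the level (remainder) piece of the rung (`stub_rungLevelPart`)

Route `LiouvilleShiftedTables` (Parity / GeneralizedHardyLittlewood), crux stmt-Parity-9389
(`PairsToGHL`), line `sloped_ladder`, registered stub `stub_rungLevelPart`.

For a positive `t`-system `Φ` and a positive form `ψ(n) = a n + b` with `vecCons ψ Φ`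
non-degenerate, put `F(n) = ∏ᵢ Λ(Φᵢ(n))`, `m(n) = ψ(n)`, `M₀ = ⌊N^{ε₁}⌋`, `X(n) = m(n)/(M₀+1)` and
let `W(d)` be the rung weight (`= 𝟙[gcd(a,d) ∣ b] · w_Φ(d', ρ_d)`, `d' = d/gcd(a,d)`, `ρ_d` the class
of `{n : d ∣ a n + b}` mod `d'`). Assuming the Level hypothesis for `F` (relative
Elliott–Halberstam: level `N^{1-δ}`, one class and one height per modulus), the remainder

  `E(N) = ∑_{n ≤ N} F(n) ∑_{d ≤ X(n)} μ(d) (𝟙[d ∣ m(n)] - W(d)) log(m(n)/d)`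

is `o(N)` (Bombieri's asymptotic sieve, the step "`∑_{d ≤ D} |r_d|` small"):

* `exists_classFn`, `weight_eq_zero_of_not_dvd`, `weight_eq_of_dvd`, `partialSum_eq_zero_of_not_dvd`,
  `partialSum_eq_of_dvd` — the progression `{n : d ∣ a n + b}` is empty unless `gcd(a,d) ∣ b` and
  then one class `ρ_d mod d'` (the atoms piece's `RungAtoms.no_solution_of_not_dvd`,
  `RungAtoms.exists_class_of_dvd`); accordingly `W(d) = 0`, resp. `W(d) = w(d', ρ_d)`, and the
  partial sums of `(𝟙[d ∣ a n + b] - W(d)) F(n)` vanish, resp. are the level summand at `(d', ρ_d)`;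
* `abelWeight_nonneg`, `abelWeight_mono`, `abelWeight_le` — the Abel weight
  `𝟙[d ≤ X(n)] log(m(n)/d)` is non-negative, non-decreasing in `n` and `≤ log((a+b)N)`;
* `main_estimate` — the deterministic inequality: for `N ≥ 1`, any `K` and `D₁ ≥ X(N)`,
  `|E(N)| ≤ 2 log((a+b)N) · τ(a) · R` whenever every level sum of modulus `≤ D₁` and heights `≤ N`
  is `≤ R` (swap the sums, Abel summation in `n` — part 1 —, evaluate the partial sums, re-index by
  `gcd(a,d)`);
* `core`, `level_abstract` — `E(N) = o(N)` for natural parameters (Level at `δ = ε₁/2`, `B = 3`),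
  resp. with the data `m`, `gcd(a,·)`, `d ∣ ψ(ρ)` abstracted as functions;
* `stub_rungLevelPart` — the registered signature (`a = ψ̇(e₁)`, `b = ψ(0)`, `ψ(![x]) = a x + b`).

[folklore]
-/

open Finset Filter

namespace Summit.Parity.GeneralizedHardyLittlewood.Theorems.PairsToGHL.SlopedLadder

namespace RungLevel

/-! ### The progression `{n : d ∣ a n + b}` -/

/-- A class function `d ↦ ρ_d`: for every `d ≥ 1` with `gcd(a,d) ∣ b`, `ρ_d < d' := d/gcd(a,d)`
and `d ∣ a n + b ↔ n ≡ ρ_d (mod d')`. [folklore] -/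
theorem exists_classFn {a : ℕ} (ha : 0 < a) (b : ℕ) :
    ∃ ρ : ℕ → ℕ, ∀ d, 0 < d → Nat.gcd a d ∣ b →
      (ρ d < d / Nat.gcd a d ∧ ∀ n : ℕ, (d ∣ a * n + b ↔ n ≡ ρ d [MOD d / Nat.gcd a d])) := by
  classical
  refine ⟨fun d => if h : 0 < d ∧ Nat.gcd a d ∣ b then
      (RungAtoms.exists_class_of_dvd ha h.1 h.2).choose else 0, fun d hd h => ?_⟩
  have hc : (0 < d ∧ Nat.gcd a d ∣ b) := ⟨hd, h⟩
  simp only [dif_pos hc]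
  exact (RungAtoms.exists_class_of_dvd ha hd h).choose_spec

/-! ### The rung weight -/

section Weight

variable {a b : ℕ} (w : ℕ → ℕ → ℝ) {W : ℕ → ℝ}
  (hW : ∀ d, W d = ∑ ρ ∈ range (d / Nat.gcd a d),
    if d ∣ a * ρ + b then w (d / Nat.gcd a d) ρ else 0)
include hW

/-- If `gcd(a,d) ∤ b` then `W d = 0` (no candidate `ρ` is a root). [folklore] -/
theorem weight_eq_zero_of_not_dvd {d : ℕ} (h : ¬ Nat.gcd a d ∣ b) : W d = 0 := by
  rw [hW]
  exact Finset.sum_eq_zero fun ρ _ => if_neg (RungAtoms.no_solution_of_not_dvd h ρ)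

/-- If `gcd(a,d) ∣ b` then `W d = w(d', ρ_d)`: the only root below `d'` is `ρ_d`. [folklore] -/
theorem weight_eq_of_dvd {ρ : ℕ → ℕ}
    (hρ : ∀ d, 0 < d → Nat.gcd a d ∣ b →
      (ρ d < d / Nat.gcd a d ∧ ∀ n : ℕ, (d ∣ a * n + b ↔ n ≡ ρ d [MOD d / Nat.gcd a d])))
    {d : ℕ} (hd : 0 < d) (h : Nat.gcd a d ∣ b) : W d = w (d / Nat.gcd a d) (ρ d) := by
  obtain ⟨hlt, hiff⟩ := hρ d hd h
  rw [hW, Finset.sum_eq_single_of_mem (ρ d) (mem_range.2 hlt)]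
  · rw [if_pos ((hiff _).2 (Nat.ModEq.refl _))]
  · intro ρ' hρ' hne
    rw [if_neg]
    intro hdv
    exact hne (Nat.ModEq.eq_of_lt_of_lt ((hiff ρ').1 hdv) (mem_range.1 hρ') hlt)

/-- If `gcd(a,d) ∤ b`, the partial sums of `(𝟙[d ∣ a n + b] - W d) F n` vanish. [folklore] -/
theorem partialSum_eq_zero_of_not_dvd (F : ℕ → ℝ) {d : ℕ} (h : ¬ Nat.gcd a d ∣ b) (y : ℕ) :
    ∑ n ∈ Icc 1 y, ((if d ∣ a * n + b then (1 : ℝ) else 0) - W d) * F n = 0 := by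
  refine Finset.sum_eq_zero fun n _ => ?_
  rw [if_neg (RungAtoms.no_solution_of_not_dvd h n), weight_eq_zero_of_not_dvd w hW h, sub_zero,
    zero_mul]

/-- If `gcd(a,d) ∣ b`, the partial sum of `(𝟙[d ∣ a n + b] - W d) F n` over `n ≤ y` is the
level summand `∑_{n ≤ y, n ≡ ρ_d (d')} F n - w(d', ρ_d) ∑_{n ≤ y} F n`. [folklore] -/
theorem partialSum_eq_of_dvd (F : ℕ → ℝ) {ρ : ℕ → ℕ}
    (hρ : ∀ d, 0 < d → Nat.gcd a d ∣ b →
      (ρ d < d / Nat.gcd a d ∧ ∀ n : ℕ, (d ∣ a * n + b ↔ n ≡ ρ d [MOD d / Nat.gcd a d])))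
    {d : ℕ} (hd : 0 < d) (h : Nat.gcd a d ∣ b) (y : ℕ) :
    ∑ n ∈ Icc 1 y, ((if d ∣ a * n + b then (1 : ℝ) else 0) - W d) * F n =
      (∑ n ∈ (Icc 1 y).filter (fun n : ℕ => n ≡ ρ d [MOD d / Nat.gcd a d]), F n) -
        w (d / Nat.gcd a d) (ρ d) * ∑ n ∈ Icc 1 y, F n := by
  obtain ⟨_, hiff⟩ := hρ d hd h
  rw [weight_eq_of_dvd w hW hρ hd h, Finset.sum_filter, Finset.mul_sum, ← Finset.sum_sub_distrib]
  refine Finset.sum_congr rfl fun n _ => ?_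
  rw [if_congr (hiff n) rfl rfl]
  split_ifs <;> ring

end Weight

/-! ### The Abel weight `𝟙[d ≤ X(n)] log(m(n)/d)` -/

/-- For `1 ≤ d ≤ m / K`: `0 ≤ log(m/d)`. [folklore] -/
theorem log_div_nonneg {m K d : ℕ} (hd : 1 ≤ d) (hdX : d ≤ m / K) :
    0 ≤ Real.log ((m : ℝ) / d) := by
  have hdm : d ≤ m := hdX.trans (Nat.div_le_self m K)
  have hd0 : (0 : ℝ) < d := by exact_mod_cast hd
  refine Real.log_nonneg ?_
  rw [le_div_iff₀ hd0, one_mul]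
  exact_mod_cast hdm

/-- The Abel weight is non-negative. [folklore] -/
theorem abelWeight_nonneg (a b K : ℕ) {d : ℕ} (hd : 1 ≤ d) (n : ℕ) :
    0 ≤ (if d ≤ (a * n + b) / K then Real.log (((a * n + b : ℕ) : ℝ) / d) else 0) := by
  split_ifs with h
  · exact log_div_nonneg hd h
  · exact le_rfl

/-- The Abel weight is non-decreasing in `n`. [folklore] -/
theorem abelWeight_mono (a b K : ℕ) {d : ℕ} (hd : 1 ≤ d) {n n' : ℕ} (hnn' : n ≤ n') :
    (if d ≤ (a * n + b) / K then Real.log (((a * n + b : ℕ) : ℝ) / d) else 0) ≤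
      (if d ≤ (a * n' + b) / K then Real.log (((a * n' + b : ℕ) : ℝ) / d) else 0) := by
  have hmm : a * n + b ≤ a * n' + b := by nlinarith
  by_cases h : d ≤ (a * n + b) / K
  · have h' : d ≤ (a * n' + b) / K := h.trans (Nat.div_le_div_right hmm)
    rw [if_pos h, if_pos h']
    have hd0 : (0 : ℝ) < d := by exact_mod_cast hd
    have hm0 : (0 : ℝ) < ((a * n + b : ℕ) : ℝ) := by
      have : d ≤ a * n + b := h.trans (Nat.div_le_self _ K)
      exact_mod_cast (show 0 < a * n + b by omega)
    refine Real.log_le_log (div_pos hm0 hd0) ?_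
    gcongr
  · rw [if_neg h]
    exact abelWeight_nonneg a b K hd n'

/-- The Abel weight at `n = N ≥ 1` is at most `log((a+b)N)` (`a ≥ 1`). [folklore] -/
theorem abelWeight_le {a : ℕ} (ha : 0 < a) (b K : ℕ) {d : ℕ} (hd : 1 ≤ d) {N : ℕ} (hN : 1 ≤ N) :
    (if d ≤ (a * N + b) / K then Real.log (((a * N + b : ℕ) : ℝ) / d) else 0) ≤
      Real.log (((a + b) * N : ℕ) : ℝ) := by
  have hle : a * N + b ≤ (a + b) * N := by nlinarith
  have h1 : (1 : ℝ) ≤ (((a + b) * N : ℕ) : ℝ) := by exact_mod_cast (show 1 ≤ (a + b) * N by nlinarith)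
  split_ifs with h
  · have hd0 : (0 : ℝ) < d := by exact_mod_cast hd
    have hm0 : (0 : ℝ) < ((a * N + b : ℕ) : ℝ) := by exact_mod_cast (show 0 < a * N + b by nlinarith)
    refine Real.log_le_log (div_pos hm0 hd0) ?_
    calc ((a * N + b : ℕ) : ℝ) / d ≤ ((a * N + b : ℕ) : ℝ) := div_le_self hm0.le (by exact_mod_cast hd)
      _ ≤ (((a + b) * N : ℕ) : ℝ) := by exact_mod_cast hle
  · exact Real.log_nonneg h1

/-! ### The deterministic estimate -/

section Estimate

variable (F : ℕ → ℝ) (w : ℕ → ℕ → ℝ) {a b : ℕ} (ha : 0 < a) {W : ℕ → ℝ}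
  (hW : ∀ d, W d = ∑ ρ ∈ range (d / Nat.gcd a d),
    if d ∣ a * ρ + b then w (d / Nat.gcd a d) ρ else 0)
include ha hW

/-- **The remainder of the rung against the level sums.** For `N, K ≥ 1`, `X(N) ≤ D₁` and a
bound `R` for all level sums of modulus `≤ D₁` and heights `≤ N`:
`|∑_{n ≤ N} F(n) ∑_{d ≤ X(n)} μ(d)(𝟙[d ∣ m(n)] - W(d)) log(m(n)/d)| ≤ 2 log((a+b)N) τ(a) R`.
[folklore] -/
theorem main_estimate {N : ℕ} (hN : 1 ≤ N) (K : ℕ) {D₁ : ℕ} (hD : (a * N + b) / K ≤ D₁)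
    {R : ℝ}
    (hR : ∀ r Y : ℕ → ℕ, (∀ e, Y e ≤ N) →
      ∑ e ∈ Icc 1 D₁, |(∑ n ∈ (Icc 1 (Y e)).filter (fun n : ℕ => n ≡ r e [MOD e]), F n) -
        w e (r e) * ∑ n ∈ Icc 1 (Y e), F n| ≤ R) :
    |∑ n ∈ Icc 1 N, F n * ∑ d ∈ Icc 1 ((a * n + b) / K),
        (ArithmeticFunction.moebius d : ℝ) * ((if d ∣ a * n + b then (1 : ℝ) else 0) - W d) *
          Real.log (((a * n + b : ℕ) : ℝ) / d)| ≤
      2 * Real.log (((a + b) * N : ℕ) : ℝ) * ((Nat.divisors a).card * R) := by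
  obtain ⟨ρ, hρ⟩ := exists_classFn ha b
  set D := (a * N + b) / K with hDdef
  have hX : ∀ n ∈ Icc 1 N, (a * n + b) / K ≤ D := fun n hn => by
    have := (mem_Icc.1 hn).2
    exact Nat.div_le_div_right (by nlinarith)
  -- swap the sums
  simp_rw [Finset.mul_sum]
  rw [sum_swap_indicator N D _ hX]
  have hinner : ∀ d ∈ Icc 1 D,
      (∑ n ∈ Icc 1 N, if d ≤ (a * n + b) / K then
        F n * ((ArithmeticFunction.moebius d : ℝ) * ((if d ∣ a * n + b then (1 : ℝ) else 0) - W d) *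
          Real.log (((a * n + b : ℕ) : ℝ) / d)) else 0) =
      (ArithmeticFunction.moebius d : ℝ) * ∑ n ∈ Icc 1 N,
        (if d ≤ (a * n + b) / K then Real.log (((a * n + b : ℕ) : ℝ) / d) else 0) *
          (((if d ∣ a * n + b then (1 : ℝ) else 0) - W d) * F n) := by
    intro d _
    rw [Finset.mul_sum]
    refine Finset.sum_congr rfl fun n _ => ?_
    split_ifs <;> ring
  rw [Finset.sum_congr rfl hinner]
  refine (abs_sum_moebius_mul_le _ _).trans ?_
  -- maximising heights
  obtain ⟨y, hyN, hymax⟩ := exists_maximizer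
    (fun d y => ∑ n ∈ Icc 1 y, ((if d ∣ a * n + b then (1 : ℝ) else 0) - W d) * F n) N
  have hL0 : 0 ≤ Real.log (((a + b) * N : ℕ) : ℝ) :=
    Real.log_nonneg (by exact_mod_cast (show 1 ≤ (a + b) * N by nlinarith))
  -- Abel summation, modulus by modulus
  have hterm : ∀ d ∈ Icc 1 D,
      |∑ n ∈ Icc 1 N, (if d ≤ (a * n + b) / K then Real.log (((a * n + b : ℕ) : ℝ) / d) else 0) *
          (((if d ∣ a * n + b then (1 : ℝ) else 0) - W d) * F n)| ≤
        2 * Real.log (((a + b) * N : ℕ) : ℝ) *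
          |∑ n ∈ Icc 1 (y d), ((if d ∣ a * n + b then (1 : ℝ) else 0) - W d) * F n| := by
    intro d hd
    have hd1 : 1 ≤ d := (mem_Icc.1 hd).1
    refine (abel_bound _ _ hN _ (abelWeight_nonneg a b K hd1 1)
      (fun n _ _ => abelWeight_mono a b K hd1 (Nat.le_succ n)) (fun y' hy' => hymax d y' hy')).trans ?_
    have h1 := abelWeight_le ha b K hd1 hN
    have h2 := abs_nonneg (∑ n ∈ Icc 1 (y d), ((if d ∣ a * n + b then (1 : ℝ) else 0) - W d) * F n)
    gcongr
  refine (Finset.sum_le_sum hterm).trans ?_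
  rw [← Finset.mul_sum]
  refine mul_le_mul_of_nonneg_left ?_ (by positivity)
  -- partial sums are level summands; re-index by `gcd(a, d)`
  calc ∑ d ∈ Icc 1 D, |∑ n ∈ Icc 1 (y d), ((if d ∣ a * n + b then (1 : ℝ) else 0) - W d) * F n|
      ≤ ∑ d ∈ Icc 1 D, |(∑ n ∈ (Icc 1 (y d)).filter
            (fun n : ℕ => n ≡ ρ d [MOD d / Nat.gcd a d]), F n) -
          w (d / Nat.gcd a d) (ρ d) * ∑ n ∈ Icc 1 (y d), F n| := by
        refine Finset.sum_le_sum fun d hd => ?_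
        have hd1 : 0 < d := (mem_Icc.1 hd).1
        by_cases h : Nat.gcd a d ∣ b
        · rw [partialSum_eq_of_dvd w hW F hρ hd1 h]
        · rw [partialSum_eq_zero_of_not_dvd w hW F h, abs_zero]
          exact abs_nonneg _
    _ ≤ (Nat.divisors a).card * R :=
        sum_reindex_le ha hD (fun e r' y' => (∑ n ∈ (Icc 1 y').filter
          (fun n : ℕ => n ≡ r' [MOD e]), F n) - w e r' * ∑ n ∈ Icc 1 y', F n) ρ y hyN R hR

end Estimate

/-! ### The remainder is `o(N)` -/

/-- **The level piece, natural parameters.** For `a ≥ 1`, `b`, any `F` and density `w`, the rung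
weight `W(d) = ∑_{ρ < d'} 𝟙[d ∣ aρ+b] w(d', ρ)` and the Level hypothesis for `(F, w)`:
`E(N) = o(N)`. [folklore] -/
theorem core (F : ℕ → ℝ) (w : ℕ → ℕ → ℝ) {a b : ℕ} (ha : 0 < a) {W : ℕ → ℝ}
    (hW : ∀ d, W d = ∑ ρ ∈ range (d / Nat.gcd a d),
      if d ∣ a * ρ + b then w (d / Nat.gcd a d) ρ else 0)
    (hLevel : ∀ δ : ℝ, 0 < δ → ∀ B : ℝ, ∃ C : ℝ, ∀ N : ℕ, 2 ≤ N → ∀ y r : ℕ → ℕ,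
      (∀ d, y d ≤ N) →
      (∑ d ∈ Finset.Icc 1 ⌊(N : ℝ) ^ (1 - δ)⌋₊,
        |(∑ n ∈ (Finset.Icc 1 (y d)).filter (fun n : ℕ => n ≡ r d [MOD d]), F n) -
          w d (r d) * ∑ n ∈ Finset.Icc 1 (y d), F n|) ≤ C * N / Real.log N ^ B) :
    ∀ ε₁ : ℝ, 0 < ε₁ → ∀ η : ℝ, 0 < η → ∃ N₀ : ℕ, ∀ N : ℕ, N₀ ≤ N →
      |∑ n ∈ Finset.Icc 1 N, F n * ∑ d ∈ Finset.Icc 1 ((a * n + b) / (⌊(N : ℝ) ^ ε₁⌋₊ + 1)),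
        (ArithmeticFunction.moebius d : ℝ) * ((if d ∣ a * n + b then (1 : ℝ) else 0) - W d) *
          Real.log (((a * n + b : ℕ) : ℝ) / d)| ≤ η * N := by
  intro ε₁ hε₁ η hη
  obtain ⟨C, hC⟩ := hLevel (ε₁ / 2) (half_pos hε₁) ((3 : ℕ) : ℝ)
  set τ : ℝ := ((Nat.divisors a).card : ℝ) with hτ
  have hτ0 : 0 ≤ τ := Nat.cast_nonneg _
  set C' : ℝ := max C 0 with hC'
  have hC'0 : 0 ≤ C' := le_max_right _ _
  have hlog := (Real.tendsto_log_atTop.comp tendsto_natCast_atTop_atTop).eventually_ge_atTop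
    (max 1 (4 * τ * C' / η))
  have hev : ∀ᶠ N : ℕ in atTop,
      |∑ n ∈ Finset.Icc 1 N, F n * ∑ d ∈ Finset.Icc 1 ((a * n + b) / (⌊(N : ℝ) ^ ε₁⌋₊ + 1)),
        (ArithmeticFunction.moebius d : ℝ) * ((if d ∣ a * n + b then (1 : ℝ) else 0) - W d) *
          Real.log (((a * n + b : ℕ) : ℝ) / d)| ≤ η * N := by
    filter_upwards [level_le_eventually a b hε₁, hlog, eventually_ge_atTop (max 2 (a + b))]
      with N hD hℓ hN
    rw [Function.comp_apply, max_le_iff] at hℓ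
    rw [max_le_iff] at hN
    have hN1 : 1 ≤ N := le_trans (by norm_num) hN.1
    have hR : ∀ r Y : ℕ → ℕ, (∀ e, Y e ≤ N) →
        ∑ e ∈ Icc 1 ⌊(N : ℝ) ^ (1 - ε₁ / 2)⌋₊, |(∑ n ∈ (Icc 1 (Y e)).filter
          (fun n : ℕ => n ≡ r e [MOD e]), F n) - w e (r e) * ∑ n ∈ Icc 1 (Y e), F n| ≤
          C' * N / Real.log N ^ (3 : ℕ) := by
      intro r Y hY
      refine (hC N hN.1 Y r hY).trans ?_
      rw [Real.rpow_natCast]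
      have : 0 ≤ (N : ℝ) / Real.log N ^ (3 : ℕ) := by
        have : 0 < Real.log N := by linarith [hℓ.1]
        positivity
      calc C * N / Real.log N ^ (3 : ℕ) = C * (N / Real.log N ^ (3 : ℕ)) := by ring
        _ ≤ C' * (N / Real.log N ^ (3 : ℕ)) := mul_le_mul_of_nonneg_right (le_max_left _ _) this
        _ = C' * N / Real.log N ^ (3 : ℕ) := by ring
    refine (main_estimate F w ha hW hN1 _ hD hR).trans ?_
    have hab : (((a + b) * N : ℕ) : ℝ) = ((a + b : ℕ) : ℝ) * N := by push_cast; ring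
    have hab0 : (0 : ℝ) < ((a + b : ℕ) : ℝ) := by exact_mod_cast (show 0 < a + b by omega)
    have hN0 : (0 : ℝ) < N := by exact_mod_cast hN1
    have hL : Real.log (((a + b) * N : ℕ) : ℝ) ≤ 2 * Real.log N := by
      rw [hab, Real.log_mul hab0.ne' hN0.ne', two_mul]
      refine add_le_add (Real.log_le_log hab0 ?_) le_rfl
      exact_mod_cast hN.2
    have hη' : 4 * τ * C' ≤ η * Real.log N := by
      have h2 := hℓ.2
      rw [div_le_iff₀ hη] at h2
      linarith [mul_comm (Real.log (N : ℝ)) η]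
    exact log_bookkeeping hL hℓ.1 hτ0 hC'0 hη.le hN0.le hη'
  obtain ⟨N₀, hN₀⟩ := Filter.eventually_atTop.mp hev
  exact ⟨N₀, hN₀⟩

/-- **The level piece, abstract data.** As `core`, with `m(n) = a n + b`, `g(d) = gcd(a, d)` and
the root predicate `P d ρ ↔ d ∣ a ρ + b` carried by functions. [folklore] -/
theorem level_abstract (F : ℕ → ℝ) (m : ℕ → ℕ) (g : ℕ → ℕ) (P : ℕ → ℕ → Prop)
    [∀ d ρ, Decidable (P d ρ)] (w : ℕ → ℕ → ℝ) (a b : ℕ) (ha : 0 < a)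
    (hm : ∀ n, m n = a * n + b) (hg : ∀ d, g d = Nat.gcd a d)
    (hP : ∀ d ρ, P d ρ ↔ d ∣ a * ρ + b)
    (hLevel : ∀ δ : ℝ, 0 < δ → ∀ B : ℝ, ∃ C : ℝ, ∀ N : ℕ, 2 ≤ N → ∀ y r : ℕ → ℕ,
      (∀ d, y d ≤ N) →
      (∑ d ∈ Finset.Icc 1 ⌊(N : ℝ) ^ (1 - δ)⌋₊,
        |(∑ n ∈ (Finset.Icc 1 (y d)).filter (fun n : ℕ => n ≡ r d [MOD d]), F n) -
          w d (r d) * ∑ n ∈ Finset.Icc 1 (y d), F n|) ≤ C * N / Real.log N ^ B) :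
    ∀ ε₁ : ℝ, 0 < ε₁ → ε₁ ≤ 1 / 8 → ∀ η : ℝ, 0 < η → ∃ N₀ : ℕ, ∀ N : ℕ, N₀ ≤ N →
      |∑ n ∈ Finset.Icc 1 N, F n * ∑ d ∈ Finset.Icc 1 (m n / (⌊(N : ℝ) ^ ε₁⌋₊ + 1)),
        (ArithmeticFunction.moebius d : ℝ) * ((if d ∣ m n then (1 : ℝ) else 0) -
          (∑ ρ ∈ Finset.range (d / g d), if P d ρ then w (d / g d) ρ else (0 : ℝ))) *
          Real.log ((m n : ℝ) / d)| ≤ η * N := by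
  intro ε₁ hε₁ _ η hη
  have hW : ∀ d, (∑ ρ ∈ Finset.range (d / g d), if P d ρ then w (d / g d) ρ else (0 : ℝ)) =
      ∑ ρ ∈ Finset.range (d / Nat.gcd a d), if d ∣ a * ρ + b then w (d / Nat.gcd a d) ρ else 0 :=
    fun d => by
      rw [hg]
      exact Finset.sum_congr rfl fun ρ _ => if_congr (hP d ρ) rfl rfl
  obtain rfl : m = fun n => a * n + b := funext hm
  exact core F w ha (W := fun d => ∑ ρ ∈ Finset.range (d / g d), if P d ρ then w (d / g d) ρ else 0)
    hW hLevel ε₁ hε₁ η hη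

end RungLevel

open RungLevel

/-- **`stub_rungLevelPart` — the level (remainder) piece of the rung.** For every positive
`t`-system `Φ` and positive `ψ` with `vecCons ψ Φ` non-degenerate, assuming the Level hypothesis
(relative Elliott–Halberstam) for the tuple weight `F = ∏ᵢ Λ ∘ Φᵢ`: for every `ε₁ ∈ (0, 1/8]`,
with `M₀ = ⌊N^{ε₁}⌋`, `m = ψ(n)`, `X(n) = m/(M₀+1)` and the rung weight `W`, the remainder
`∑_{n ≤ N} F(n) ∑_{d ≤ X(n)} μ(d) (𝟙[d ∣ m] - W(d)) log(m/d)` is `o(N)`: swap the sums, Abel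
summation with the monotone weight `𝟙[d ≤ X(n)] log(m/d)`, the progression `{n : d ∣ a n + b}` is
one class mod `d/gcd(a,d)` (or empty), re-index by `gcd(a,d) ∣ a` and apply Level once per
divisor of `a` with `δ = ε₁/2`, `B = 3` (Bombieri's asymptotic sieve, the remainder step).
[folklore] -/
theorem stub_rungLevelPart :
    ∀ t : ℕ, 1 ≤ t → ∀ (Φ : Fin t → Literature.NumberTheory.Sieve.AffLinForm 1) (ψ : Literature.NumberTheory.Sieve.AffLinForm 1), Literature.NumberTheory.Sieve.IsNondegenerateSystem (Matrix.vecCons ψ Φ) → (∀ i, 0 < (Φ i).coeff 0 ∧ 0 ≤ (Φ i).const) → (0 < ψ.coeff 0 ∧ 0 ≤ ψ.const) → (∀ δ : ℝ, 0 < δ → ∀ B : ℝ, ∃ C : ℝ, ∀ N : ℕ, 2 ≤ N → ∀ y r : ℕ → ℕ, (∀ d, y d ≤ N) → (∑ d ∈ Finset.Icc 1 ⌊(N : ℝ) ^ (1 - δ)⌋₊, |(∑ n ∈ (Finset.Icc 1 (y d)).filter (fun n : ℕ => n ≡ r d [MOD d]), ∏ i, Literature.NumberTheory.Sieve.intVonMangoldt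 ((Φ i).eval ![(n : ℤ)])) - (if ∀ i, Int.gcd ((Φ i).eval ![(r d : ℤ)]) d = 1 then ((((Finset.range d).filter (fun ρ : ℕ => ∀ i, Int.gcd ((Φ i).eval ![(ρ : ℤ)]) d = 1)).card : ℝ))⁻¹ else 0) * ∑ n ∈ Finset.Icc 1 (y d), ∏ i, Literature.NumberTheory.Sieve.intVonMangoldt ((Φ i).eval ![(n : ℤ)])|) ≤ C * N / Real.log N ^ B) → ∀ ε₁ : ℝ, 0 < ε₁ → ε₁ ≤ 1 / 8 → ∀ η : ℝ, 0 < η → ∃ N₀ : ℕ, ∀ N : ℕ, N₀ ≤ N → |∑ n ∈ Finset.Icc 1 N, (∏ i, Literature.NumberTheory.Sieve.intVonMangoldt ((Φ i).eval ![(n : ℤ)])) * ∑ d ∈ Finset.Icc 1 (Int.toNat (ψ.eval ![(n : ℤ)]) / (⌊(N : ℝ) ^ ε₁⌋₊ + 1)), (ArithmeticFunction.moebius d : ℝ) * ((if d ∣ Int.toNat (ψ.eval ![(n : ℤ)]) then (1 : ℝ) else 0) - (∑ ρ ∈ Finset.range (d / Int.gcd (ψ.coeff 0) d), if (d : ℤ)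 ∣ ψ.eval ![(ρ : ℤ)] then (if ∀ i, Int.gcd ((Φ i).eval ![(ρ : ℤ)]) (d / Int.gcd (ψ.coeff 0) d) = 1 then ((((Finset.range (d / Int.gcd (ψ.coeff 0) d)).filter (fun ρ' : ℕ => ∀ i, Int.gcd ((Φ i).eval ![(ρ' : ℤ)]) (d / Int.gcd (ψ.coeff 0) d) = 1)).card : ℝ))⁻¹ else 0) else (0 : ℝ))) * Real.log ((Int.toNat (ψ.eval ![(n : ℤ)]) : ℝ) / d)| ≤ η * N := by
  intro t _ Φ ψ _ _ hψ hLevel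
  obtain ⟨a, ha, ha0⟩ : ∃ a : ℕ, ψ.coeff 0 = a ∧ 0 < a :=
    ⟨(ψ.coeff 0).toNat, (Int.toNat_of_nonneg hψ.1.le).symm, by have := hψ.1; omega⟩
  obtain ⟨b, hb⟩ : ∃ b : ℕ, ψ.const = b := ⟨ψ.const.toNat, (Int.toNat_of_nonneg hψ.2).symm⟩
  have heval : ∀ x : ℕ, ψ.eval ![(x : ℤ)] = ((a * x + b : ℕ) : ℤ) := fun x => by
    rw [show ψ.eval ![(x : ℤ)] = ψ.coeff 0 * x + ψ.const by
      simp [Literature.NumberTheory.Sieve.AffLinForm.eval], ha, hb]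
    push_cast
    ring
  exact level_abstract (fun n => ∏ i, Literature.NumberTheory.Sieve.intVonMangoldt ((Φ i).eval ![(n : ℤ)]))
    (fun n => Int.toNat (ψ.eval ![(n : ℤ)])) (fun d => Int.gcd (ψ.coeff 0) d)
    (fun d ρ => (d : ℤ) ∣ ψ.eval ![(ρ : ℤ)])
    (fun q r => if ∀ i, Int.gcd ((Φ i).eval ![(r : ℤ)]) q = 1 then
      ((((Finset.range q).filter
        (fun ρ' : ℕ => ∀ i, Int.gcd ((Φ i).eval ![(ρ' : ℤ)]) q = 1)).card : ℝ))⁻¹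
      else 0) a b ha0 (fun n => by simp only [heval, Int.toNat_natCast])
    (fun d => by rw [ha, Int.gcd_natCast_natCast])
    (fun d ρ => by simp only [heval, Int.natCast_dvd_natCast]) hLevel

end Summit.Parity.GeneralizedHardyLittlewood.Theorems.PairsToGHL.SlopedLadder
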